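import Mathlib
import Summits.KontsevichZagierPeriods.KontsevichZagierPeriods.Theorems.SoloInformedLocalSide
import Summits.KontsevichZagierPeriods.KontsevichZagierPeriods.Theorems.SoloInformedAlgSwap
import HarnessLib
import HarnessLib.Audit

/-!
# SoloInformed — NONINT at a smooth frontier point of the boundary curve (PRES-RAT(2), Phase IV-6)

Solo programme `solo-KontsevichZagierPeriods-informed`, session s110.  Let `K ⊆ ℝ` be a field,
`N, D, C ∈ K[x, y]`, `Ω ⊆ ℝ²` open with `frontier Ω ⊆ Z(C)`, and `f = N/D` on `Ω` (`D ≠ 0` on `Ω`)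
integrable.  Let `p ∈ frontier Ω` be a point with `C(p) = 0`, `∇C(p) ≠ 0`, `N(p) ≠ 0`, such that
near `p` every real zero of `C` is a zero of `D`.  Then: contradiction
(`soloInformed_nonint_smoothPoint`).

Proof.  If `∂C/∂y (p) ≠ 0`, the complex-analytic implicit function theorem
(`soloInformed_exists_cxImplicit`) makes `Z(C)` near `p` the graph of a real-analytic function
`a`; the frontier of `Ω` in a small box lies on this graph, so (file SoloInformedLocalSide) `Ω`
contains a band adjacent to a branch of `Z(D)` on which `N ≠ 0` — impossible by NONINT-LOCAL.
If `∂C/∂x (p) ≠ 0` we swap the coordinates (the swap is a measure-preserving homeomorphism and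
acts on `K[x, y]` by `soloInformedSwapK`).

References: folklore.
-/

noncomputable section

open scoped BigOperators Topology
open MeasureTheory Set Filter Metric

namespace Summit.KontsevichZagierPeriods.KontsevichZagierPeriods.Theorems

variable {K : Type*} [Field K] [Algebra K ℝ]

/-- Complex evaluation at real points is the real evaluation. -/
theorem soloInformed_evalC_ofReal (Q : MvPolynomial (Fin 2) K) (x s : ℝ) :
    soloInformedEvalC (soloInformedKToC K) Q (x : ℂ) (s : ℂ) =
      ((MvPolynomial.aeval ![x, s] Q : ℝ) : ℂ) := by
  have h := soloInformed_ofReal_aevalK (K := K) ![x, s] Q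
  have ht : soloInformedToC 2 ![x, s] = ![(x : ℂ), (s : ℂ)] := by
    funext i
    fin_cases i <;> simp [soloInformedToC_apply]
  unfold soloInformedEvalC
  rw [← ht, ← h]

/-! ### Orientation `∂C/∂y ≠ 0` -/

/-- **NONINT at a smooth frontier point, `∂C/∂y (p) ≠ 0`.** -/
theorem soloInformed_nonint_smoothPoint_snd {N D C : MvPolynomial (Fin 2) K}
    {Ω : Set (Fin 2 → ℝ)} {f : (Fin 2 → ℝ) → ℝ} {p : Fin 2 → ℝ} {ε : ℝ}
    (hΩ : IsOpen Ω) (hfr : frontier Ω ⊆ {z | (MvPolynomial.aeval z C : ℝ) = 0})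
    (hCp : (MvPolynomial.aeval p C : ℝ) = 0)
    (hCy : (MvPolynomial.aeval p (MvPolynomial.pderiv 1 C) : ℝ) ≠ 0) (hε : 0 < ε)
    (hloc : ∀ z : Fin 2 → ℝ, |z 0 - p 0| < ε → |z 1 - p 1| < ε →
      (MvPolynomial.aeval z C : ℝ) = 0 → (MvPolynomial.aeval z D : ℝ) = 0)
    (hpf : p ∈ frontier Ω) (hN : (MvPolynomial.aeval p N : ℝ) ≠ 0)
    (hD : ∀ z ∈ Ω, (MvPolynomial.aeval z D : ℝ) ≠ 0)
    (hf : EqOn f (fun z => (MvPolynomial.aeval z N : ℝ) / MvPolynomial.aeval z D) Ω)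
    (hint : IntegrableOn f Ω) : False := by
  have hp_eq : (![p 0, p 1] : Fin 2 → ℝ) = p := by
    funext i
    fin_cases i <;> rfl
  have hdistC : ∀ x y : ℝ, dist (x : ℂ) (y : ℂ) = |x - y| := fun x y => by
    rw [Complex.dist_eq, ← Complex.ofReal_sub, Complex.norm_real, Real.norm_eq_abs]
  -- the complex implicit function at `p`
  have h0 : soloInformedEvalC (soloInformedKToC K) C ((p 0 : ℝ) : ℂ) ((p 1 : ℝ) : ℂ) = 0 := by
    rw [soloInformed_evalC_ofReal, hp_eq, hCp, Complex.ofReal_zero]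
  have hd : soloInformedEvalC (soloInformedKToC K) (MvPolynomial.pderiv 1 C)
      ((p 0 : ℝ) : ℂ) ((p 1 : ℝ) : ℂ) ≠ 0 := by
    rw [soloInformed_evalC_ofReal, hp_eq]
    exact_mod_cast hCy
  obtain ⟨ρ, hρ, δ, hδ, A, hA, hA0, hzero, -, huniq, hreal⟩ :=
    soloInformed_exists_cxImplicit (soloInformedKToC K) soloInformed_kToC_im C (p 0) (p 1) h0 hd
  -- the real branch `a = Re ∘ A`
  set a : ℝ → ℝ := fun s => (A s).re with ha_def
  have hmemρ : ∀ s : ℝ, |s - p 0| < ρ → (s : ℂ) ∈ ball ((p 0 : ℝ) : ℂ) ρ := fun s hs => by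
    rw [mem_ball, hdistC]
    exact hs
  have hAa : ∀ s : ℝ, |s - p 0| < ρ → A s = ((a s : ℝ) : ℂ) := fun s hs => by
    apply Complex.ext
    · simp [ha_def]
    · rw [Complex.ofReal_im]
      exact hreal s (hmemρ s hs)
  have hap : a (p 0) = p 1 := by
    simp only [ha_def]
    rw [hA0, Complex.ofReal_re]
  have hderiv : ∀ s : ℝ, |s - p 0| < ρ → HasDerivAt a ((deriv A s).re) s := fun s hs =>
    ((hA (s : ℂ) (hmemρ s hs)).differentiableAt.hasDerivAt).real_of_complex
  -- sizes of the box
  set d' : ℝ := min δ ε with hd'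
  have hd'pos : 0 < d' := lt_min hδ hε
  have hd'δ : d' ≤ δ := min_le_left _ _
  have hd'ε : d' ≤ ε := min_le_right _ _
  have hcont : ContinuousAt a (p 0) := (hderiv (p 0) (by simp [hρ])).continuousAt
  obtain ⟨ρ₁, hρ₁, hρ₁a⟩ := Metric.continuousAt_iff.1 hcont d' hd'pos
  set ρ' : ℝ := min (min ρ ρ₁) ε with hρ'
  have hρ'pos : 0 < ρ' := lt_min (lt_min hρ hρ₁) hε
  have hρ'ρ : ρ' ≤ ρ := le_trans (min_le_left _ _) (min_le_left _ _)
  have hρ'ρ₁ : ρ' ≤ ρ₁ := le_trans (min_le_left _ _) (min_le_right _ _)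
  have hρ'ε : ρ' ≤ ε := min_le_right _ _
  have habs : ∀ s : ℝ, p 0 - ρ' < s → s < p 0 + ρ' → |s - p 0| < ρ' := fun s h1 h2 => by
    rw [abs_lt]
    constructor <;> linarith
  -- the graph stays inside the box `(p 0 - ρ', p 0 + ρ') × (p 1 - d', p 1 + d')`
  have hin : ∀ s : ℝ, p 0 - ρ' < s → s < p 0 + ρ' → p 1 - d' < a s ∧ a s < p 1 + d' := by
    intro s h1 h2
    have h := hρ₁a (x := s) (by rw [Real.dist_eq]; exact lt_of_lt_of_le (habs s h1 h2) hρ'ρ₁)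
    rw [Real.dist_eq, hap, abs_lt] at h
    constructor <;> linarith [h.1, h.2]
  -- in the box, the frontier of `Ω` lies on the graph
  have hfr' : ∀ z ∈ soloInformedBox2 (p 0 - ρ') (p 0 + ρ') (p 1 - d') (p 1 + d'),
      z ∈ frontier Ω → z 1 = a (z 0) := by
    intro z hz hzf
    obtain ⟨⟨hz0l, hz0r⟩, hz1l, hz1r⟩ := hz
    have hz0 : |z 0 - p 0| < ρ := lt_of_lt_of_le (habs _ hz0l hz0r) hρ'ρ
    have hz1 : ((z 1 : ℝ) : ℂ) ∈ ball ((p 1 : ℝ) : ℂ) δ := by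
      rw [mem_ball, hdistC, abs_lt]
      constructor <;> linarith
    have hCz : soloInformedEvalC (soloInformedKToC K) C ((z 0 : ℝ) : ℂ) ((z 1 : ℝ) : ℂ) = 0 := by
      have hz_eq : (![z 0, z 1] : Fin 2 → ℝ) = z := by
        funext i
        fin_cases i <;> rfl
      have hCz' : (MvPolynomial.aeval z C : ℝ) = 0 := hfr hzf
      rw [soloInformed_evalC_ofReal, hz_eq, hCz', Complex.ofReal_zero]
    have h := huniq (z 0 : ℂ) (hmemρ _ hz0) (z 1 : ℂ) hz1 hCz
    rw [hAa _ hz0, Complex.ofReal_inj] at h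
    exact h
  have hpf' : (![p 0, a (p 0)] : Fin 2 → ℝ) ∈ frontier Ω := by
    rw [hap, hp_eq]
    exact hpf
  -- the graph is a branch of `Z(D)`
  have hZ : ∀ s : ℝ, p 0 - ρ' < s → s < p 0 + ρ' →
      (MvPolynomial.aeval ![s, a s] D : ℝ) = 0 := by
    intro s h1 h2
    have hs : |s - p 0| < ρ' := habs s h1 h2
    have hCs : (MvPolynomial.aeval ![s, a s] C : ℝ) = 0 := by
      have h := hzero (s : ℂ) (hmemρ s (lt_of_lt_of_le hs hρ'ρ))
      rw [hAa s (lt_of_lt_of_le hs hρ'ρ), soloInformed_evalC_ofReal] at h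
      exact_mod_cast h
    refine hloc ![s, a s] ?_ ?_ hCs
    · simpa using lt_of_lt_of_le hs hρ'ε
    · have h := hin s h1 h2
      simp only [Matrix.cons_val_one, Matrix.cons_val_fin_one]
      rw [abs_lt]
      constructor <;> linarith [h.1, h.2]
  have hN' : (MvPolynomial.aeval ![p 0, a (p 0)] N : ℝ) ≠ 0 := by
    rw [hap, hp_eq]
    exact hN
  exact soloInformed_nonint_frontier (a' := fun s => (deriv A s).re)
    ⟨by linarith, by linarith⟩
    (fun s h1 h2 => hderiv s (lt_of_lt_of_le (habs s h1 h2) hρ'ρ)) hin hΩ hfr' hpf' hZ hN' hD hf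
    hint

/-! ### The coordinate swap -/

/-- The coordinate swap of `ℝ²` as a homeomorphism. [this work] -/
def soloInformedSwapHomeo : (Fin 2 → ℝ) ≃ₜ (Fin 2 → ℝ) where
  toFun z := ![z 1, z 0]
  invFun z := ![z 1, z 0]
  left_inv z := by
    funext i
    fin_cases i <;> rfl
  right_inv z := by
    funext i
    fin_cases i <;> rfl
  continuous_toFun := continuous_pi fun i => by
    fin_cases i
    · simpa using continuous_apply (1 : Fin 2)
    · simpa using continuous_apply (0 : Fin 2)
  continuous_invFun := continuous_pi fun i => by
    fin_cases i
    · simpa using continuous_apply (1 : Fin 2)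
    · simpa using continuous_apply (0 : Fin 2)

/-- Values of the swap homeomorphism. -/
@[simp] theorem soloInformedSwapHomeo_apply (z : Fin 2 → ℝ) :
    soloInformedSwapHomeo z = ![z 1, z 0] := rfl

/-- The swap is continuous. -/
theorem soloInformed_continuous_swapPt :
    Continuous (fun z : Fin 2 → ℝ => (![z 1, z 0] : Fin 2 → ℝ)) :=
  soloInformedSwapHomeo.continuous

/-- Frontier of a swapped set. -/
theorem soloInformed_frontier_swap_preimage (Ω : Set (Fin 2 → ℝ)) :
    frontier ((fun z : Fin 2 → ℝ => (![z 1, z 0] : Fin 2 → ℝ)) ⁻¹' Ω) =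
      (fun z : Fin 2 → ℝ => (![z 1, z 0] : Fin 2 → ℝ)) ⁻¹' frontier Ω :=
  (soloInformedSwapHomeo.preimage_frontier Ω).symm

/-- Integrability is invariant under the (measure-preserving) coordinate swap. -/
theorem soloInformed_integrableOn_comp_swap_preimage {g : (Fin 2 → ℝ) → ℝ}
    {Ω : Set (Fin 2 → ℝ)} (hg : IntegrableOn g Ω) :
    IntegrableOn (g ∘ fun z : Fin 2 → ℝ => (![z 1, z 0] : Fin 2 → ℝ))
      ((fun z : Fin 2 → ℝ => (![z 1, z 0] : Fin 2 → ℝ)) ⁻¹' Ω) := by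
  set s : (Fin 2 → ℝ) ≃ᵐ (Fin 2 → ℝ) :=
    ((MeasurableEquiv.finTwoArrow (α := ℝ)).trans MeasurableEquiv.prodComm).trans
      (MeasurableEquiv.finTwoArrow (α := ℝ)).symm with hs_def
  have hs : ∀ x : Fin 2 → ℝ, s x = ![x 1, x 0] := fun x => by
    funext i
    fin_cases i <;> simp [hs_def, MeasurableEquiv.finTwoArrow, MeasurableEquiv.prodComm]
  have h2 : MeasurePreserving (Prod.swap : ℝ × ℝ → ℝ × ℝ) volume volume :=
    Measure.measurePreserving_swap
  have hmp : MeasurePreserving s volume volume :=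
    (MeasurePreserving.symm _ (volume_preserving_finTwoArrow ℝ)).comp
      (h2.comp (volume_preserving_finTwoArrow ℝ))
  have hfun : (⇑s : (Fin 2 → ℝ) → (Fin 2 → ℝ)) = fun z => ![z 1, z 0] := funext hs
  have h := (hmp.integrableOn_comp_preimage s.measurableEmbedding).2 hg
  rwa [hfun] at h

omit [Algebra K ℝ] in
/-- `∂/∂y` of the swapped polynomial is the swap of `∂/∂x`. -/
theorem soloInformed_pderiv_one_swapK (Q : MvPolynomial (Fin 2) K) :
    MvPolynomial.pderiv 1 (soloInformedSwapK Q) = soloInformedSwapK (MvPolynomial.pderiv 0 Q) := by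
  unfold soloInformedSwapK
  have h := MvPolynomial.pderiv_rename (Equiv.swap (0 : Fin 2) 1).injective (0 : Fin 2) Q
  rw [Equiv.swap_apply_left] at h
  exact h

/-! ### Orientation `∂C/∂x ≠ 0` and the combined statement -/

/-- **NONINT at a smooth frontier point, `∂C/∂x (p) ≠ 0`** (by swapping the coordinates). -/
theorem soloInformed_nonint_smoothPoint_fst {N D C : MvPolynomial (Fin 2) K}
    {Ω : Set (Fin 2 → ℝ)} {f : (Fin 2 → ℝ) → ℝ} {p : Fin 2 → ℝ} {ε : ℝ}
    (hΩ : IsOpen Ω) (hfr : frontier Ω ⊆ {z | (MvPolynomial.aeval z C : ℝ) = 0})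
    (hCp : (MvPolynomial.aeval p C : ℝ) = 0)
    (hCx : (MvPolynomial.aeval p (MvPolynomial.pderiv 0 C) : ℝ) ≠ 0) (hε : 0 < ε)
    (hloc : ∀ z : Fin 2 → ℝ, |z 0 - p 0| < ε → |z 1 - p 1| < ε →
      (MvPolynomial.aeval z C : ℝ) = 0 → (MvPolynomial.aeval z D : ℝ) = 0)
    (hpf : p ∈ frontier Ω) (hN : (MvPolynomial.aeval p N : ℝ) ≠ 0)
    (hD : ∀ z ∈ Ω, (MvPolynomial.aeval z D : ℝ) ≠ 0)
    (hf : EqOn f (fun z => (MvPolynomial.aeval z N : ℝ) / MvPolynomial.aeval z D) Ω)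
    (hint : IntegrableOn f Ω) : False := by
  set σ : (Fin 2 → ℝ) → (Fin 2 → ℝ) := fun z => ![z 1, z 0] with hσ
  have hσp0 : σ p 0 = p 1 := by simp [hσ]
  have hσp1 : σ p 1 = p 0 := by simp [hσ]
  have hσσp : (![σ p 1, σ p 0] : Fin 2 → ℝ) = p := by
    rw [hσp0, hσp1]
    funext i
    fin_cases i <;> rfl
  have hfront : frontier (σ ⁻¹' Ω) = σ ⁻¹' frontier Ω := soloInformed_frontier_swap_preimage Ω
  refine soloInformed_nonint_smoothPoint_snd (N := soloInformedSwapK N) (D := soloInformedSwapK D)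
    (C := soloInformedSwapK C) (Ω := σ ⁻¹' Ω) (f := f ∘ σ) (p := σ p) (ε := ε)
    (hΩ.preimage soloInformed_continuous_swapPt) ?_ ?_ ?_ hε ?_ ?_ ?_ ?_ ?_
    (soloInformed_integrableOn_comp_swap_preimage hint)
  · intro z hz
    rw [hfront] at hz
    have h : (MvPolynomial.aeval (σ z) C : ℝ) = 0 := hfr hz
    simp only [mem_setOf_eq, soloInformed_aeval_swapK]
    exact h
  · rw [soloInformed_aeval_swapK, hσσp]
    exact hCp
  · rw [soloInformed_pderiv_one_swapK, soloInformed_aeval_swapK, hσσp]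
    exact hCx
  · intro z h0 h1 hC
    rw [hσp0] at h0
    rw [hσp1] at h1
    rw [soloInformed_aeval_swapK] at hC ⊢
    exact hloc ![z 1, z 0] (by simpa using h1) (by simpa using h0) hC
  · rw [hfront, mem_preimage]
    have : σ (σ p) = p := by
      funext i
      fin_cases i <;> simp [hσ]
    rw [this]
    exact hpf
  · rw [soloInformed_aeval_swapK, hσσp]
    exact hN
  · intro z hz
    rw [soloInformed_aeval_swapK]
    exact hD _ hz
  · intro z hz
    simp only [Function.comp_apply, soloInformed_aeval_swapK]
    exact hf hz

/-- **NONINT at a smooth frontier point.**  `∇C(p) ≠ 0` suffices. -/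
theorem soloInformed_nonint_smoothPoint {N D C : MvPolynomial (Fin 2) K}
    {Ω : Set (Fin 2 → ℝ)} {f : (Fin 2 → ℝ) → ℝ} {p : Fin 2 → ℝ} {ε : ℝ}
    (hΩ : IsOpen Ω) (hfr : frontier Ω ⊆ {z | (MvPolynomial.aeval z C : ℝ) = 0})
    (hCp : (MvPolynomial.aeval p C : ℝ) = 0)
    (hgrad : (MvPolynomial.aeval p (MvPolynomial.pderiv 0 C) : ℝ) ≠ 0 ∨
      (MvPolynomial.aeval p (MvPolynomial.pderiv 1 C) : ℝ) ≠ 0)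
    (hε : 0 < ε)
    (hloc : ∀ z : Fin 2 → ℝ, |z 0 - p 0| < ε → |z 1 - p 1| < ε →
      (MvPolynomial.aeval z C : ℝ) = 0 → (MvPolynomial.aeval z D : ℝ) = 0)
    (hpf : p ∈ frontier Ω) (hN : (MvPolynomial.aeval p N : ℝ) ≠ 0)
    (hD : ∀ z ∈ Ω, (MvPolynomial.aeval z D : ℝ) ≠ 0)
    (hf : EqOn f (fun z => (MvPolynomial.aeval z N : ℝ) / MvPolynomial.aeval z D) Ω)
    (hint : IntegrableOn f Ω) : False :=
  hgrad.elim
    (fun h => soloInformed_nonint_smoothPoint_fst hΩ hfr hCp h hε hloc hpf hN hD hf hint)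
    (fun h => soloInformed_nonint_smoothPoint_snd hΩ hfr hCp h hε hloc hpf hN hD hf hint)

end Summit.KontsevichZagierPeriods.KontsevichZagierPeriods.Theorems

end
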